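import Literature.AlgebraicGeometry.Morphisms.ProjectiveMorphism
import Literature.AlgebraicGeometry.Morphisms.ProjectiveSpaceSegreVeronese
import Literature.AlgebraicGeometry.Morphisms.ProjectiveSpaceOverBasePoints
import Literature.AlgebraicGeometry.Morphisms.ProjectiveSpaceOverAffine
import Literature.AlgebraicGeometry.Motives.BaseChangeProofs
import HarnessLib

/-!
# Projective morphisms are stable under base change, composition and products (Hartshorne II Ex. 4.9)

Topic `Literature/AlgebraicGeometry/Morphisms`; sequel of `Morphisms/ProjectiveMorphism`
(`Literature.AlgebraicGeometry.Morphisms.IsProjective f`: Hartshorne's projective morphisms — `f`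
factors as a closed immersion into a projective space `𝐏(ι; Y) = Y ×_{Spec ℤ} 𝐏ⁿ_ℤ` followed by
the projection; Stacks' "H-projective", Tag 01W8). That file proves projective ⇒ proper; this one
adds the three standard stability properties, over an ARBITRARY base scheme:

* `IsProjective.of_isPullback` — **stable under base change** (Stacks Tag 01WF (1)): the base
  change of `X ↪ 𝐏(ι; Y) → Y` along `Y' → Y` is `X' ↪ 𝐏(ι; Y') → Y'`, because projective space
  commutes with base change (`Literature.AlgebraicGeometry.Morphisms.isPullback_projectiveSpaceMap`,
  `Morphisms/ProjectiveSpaceOverBasePoints`) and closed immersions are stable under base change.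
* `IsProjective.comp` — **stable under composition** (Hartshorne II Ex. 4.9; Stacks Tag 01WF (2)):
  for `X ↪ 𝐏(ι; Y) → Y` and `Y ↪ 𝐏(κ; Z) → Z`,
  `X ↪ 𝐏(ι; Y) = Y ×_Z 𝐏(ι; Z) ↪ 𝐏(κ; Z) ×_Z 𝐏(ι; Z) ↪ 𝐏(τ; Z)`, the last arrow being the
  **Segre embedding over `Z`** (`Literature.AlgebraicGeometry.Morphisms.segreOver`,
  `isClosedImmersion_segreOver_left`, `Morphisms/ProjectiveSpaceSegreVeronese`; Hartshorne's hint
  "use the Segre embedding").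
* `IsProjective.pullback_fst`, `IsProjective.prod` — **fibre products of projective `S`-schemes are
  projective over `S`** (base change + composition).
* `isProjective_hom_iff_isProjectiveOver` — over a field `k`, `IsProjective X.hom` agrees with the
  tree's field-level currency `Literature.AlgebraicGeometry.Motives.IsProjectiveOver X` (a closed
  `k`-immersion into `Motives.projectiveSpace n k = Proj k[x₀,…,xₙ]`), through
  `Proj k[x₀,…,xₙ] ≅ 𝐏(ι; Spec k)` (`Morphisms/ProjectiveSpaceOverAffine`).

Everything is proved; no named facts, no definitions.

## References

* R. Hartshorne, *Algebraic Geometry*, GTM 52 (1977): II Ex. 4.9 (projective morphisms are stable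
  under base change and composition, via the Segre embedding), II §4 Definition p. 103.
  [Hartshorne1977]
* The Stacks Project, Tag 01WF (Lemma 29.43.16 in the H-projective form: base change and
  composition of H-projective morphisms), Tag 01W8, Tag 01WD (Segre). [StacksProject]
-/

noncomputable section

-- Mathlib's pull-back API is stated through `abbrev`s over `limit`; as in Mathlib's own
-- algebraic-geometry files we let `simp`/unification see through them.
set_option backward.isDefEq.respectTransparency false

universe u

open CategoryTheory CategoryTheory.Limits AlgebraicGeometry MonoidalCategory

namespace Literature.AlgebraicGeometry.Morphisms

namespace IsProjective

variable {X Y Z : Scheme.{u}}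

/-! ### Base change -/

/-- **Projective morphisms are stable under base change** (Hartshorne II Ex. 4.9 (b) / Stacks
01WF (1), H-projective form): if `f : X → Y` is projective and `X' = Y' ×_Y X`, then `X' → Y'` is
projective — `X' ↪ Y' ×_Y 𝐏(ι; Y) = 𝐏(ι; Y')`. [cite: Hartshorne1977, II Ex. 4.9] -/
theorem of_isPullback {X' Y' : Scheme.{u}} {f : X ⟶ Y} {f' : X' ⟶ Y'} {u' : X' ⟶ X} {u : Y' ⟶ Y}
    (h : IsPullback u' f' f u) (hf : IsProjective f) : IsProjective f' := by
  obtain ⟨ι, hι, j, hj, hjf⟩ := hf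
  have hP := isPullback_projectiveSpaceMap ι u
  -- the closed immersion `X' ↪ 𝐏(ι; Y')` induced by `X' → X ↪ 𝐏(ι; Y)` and `X' → Y'`
  have hw : (u' ≫ j) ≫ projectiveSpaceFst ι Y = f' ≫ u := by rw [Category.assoc, hjf]; exact h.w
  refine ⟨ι, hι, hP.lift (u' ≫ j) f' hw, ?_, hP.lift_snd _ _ _⟩
  -- it is the base change of `j` along `𝐏(ι; Y') → 𝐏(ι; Y)`
  have hs : IsPullback u' (hP.lift (u' ≫ j) f' hw ≫ projectiveSpaceFst ι Y')
      (j ≫ projectiveSpaceFst ι Y) u := by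
    rw [hP.lift_snd, hjf]
    exact h
  have htop : IsPullback u' (hP.lift (u' ≫ j) f' hw) j (projectiveSpaceMap ι u) :=
    IsPullback.of_bot hs (hP.lift_fst _ _ _).symm hP
  exact MorphismProperty.of_isPullback htop hj

/-- The first projection of a fibre product is projective when the second factor is
(`X ×_S Y → X` is the base change of `Y → S`). [cite: Hartshorne1977, II Ex. 4.9] -/
theorem pullback_fst {S : Scheme.{u}} (f : X ⟶ S) {g : Y ⟶ S} (hg : IsProjective g) :
    IsProjective (pullback.fst f g) :=
  of_isPullback (IsPullback.of_hasPullback f g).flip hg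

/-- The second projection of a fibre product is projective when the first factor is.
[cite: Hartshorne1977, II Ex. 4.9] -/
theorem pullback_snd {S : Scheme.{u}} {f : X ⟶ S} (hf : IsProjective f) (g : Y ⟶ S) :
    IsProjective (pullback.snd f g) :=
  of_isPullback (IsPullback.of_hasPullback f g) hf

/-! ### Composition (via the Segre embedding over the base) -/

/-- Numerology for the Segre target: a finite type `τ` in universe `u` with
`(#κ + 1)(#ι + 1) = #τ + 1`, together with the labelling of the product coordinates.
[cite: Hartshorne1977, II Ex. 4.9] -/
theorem exists_segreIndex (κ ι : Type u) :
    ∃ (τ : Type u) (_ : Finite τ),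
      Nonempty (Fin (Nat.card κ + 1) × Fin (Nat.card ι + 1) ≃ Fin (Nat.card τ + 1)) := by
  refine ⟨ULift.{u} (Fin ((Nat.card κ + 1) * (Nat.card ι + 1) - 1)), inferInstance, ⟨?_⟩⟩
  refine finProdFinEquiv.trans (finCongr ?_)
  rw [Nat.card_ulift, Nat.card_fin, Nat.sub_add_cancel]
  exact Nat.one_le_iff_ne_zero.mpr (Nat.mul_ne_zero (Nat.succ_ne_zero _) (Nat.succ_ne_zero _))

/-- **Projective morphisms are stable under composition** (Hartshorne II Ex. 4.9; Stacks 01WF (2)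
for H-projective morphisms): if `X ↪ 𝐏(ι; Y) → Y` and `Y ↪ 𝐏(κ; Z) → Z` then
`X ↪ 𝐏(ι; Y) = Y ×_Z 𝐏(ι; Z) ↪ 𝐏(κ; Z) ×_Z 𝐏(ι; Z) ↪ 𝐏(τ; Z)`, three closed immersions — the
given one, the base change of `Y ↪ 𝐏(κ; Z)`, and the Segre embedding over `Z`.
[cite: Hartshorne1977, II Ex. 4.9] [cite: StacksProject, Tag 01WD] -/
theorem comp {f : X ⟶ Y} {g : Y ⟶ Z} (hf : IsProjective f) (hg : IsProjective g) :
    IsProjective (f ≫ g) := by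
  obtain ⟨ι, hι, j, hj, hjf⟩ := hf
  obtain ⟨κ, hκ, i, hi, hig⟩ := hg
  obtain ⟨τ, hτ, ⟨e⟩⟩ := exists_segreIndex κ ι
  -- `𝐏(ι; Y) = Y ×_Z 𝐏(ι; Z)`
  have hP := isPullback_projectiveSpaceMap ι g
  -- `m : 𝐏(ι; Y) ⟶ 𝐏(κ; Z) ×_Z 𝐏(ι; Z)`, the base change of `i`
  have hm_w : (projectiveSpaceFst ι Y ≫ i) ≫ projectiveSpaceFst κ Z =
      projectiveSpaceMap ι g ≫ projectiveSpaceFst ι Z := by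
    rw [Category.assoc, hig, projectiveSpaceMap_fst]
  set m : projectiveSpace ι Y ⟶ pullback (projectiveSpaceFst κ Z) (projectiveSpaceFst ι Z) :=
    pullback.lift (projectiveSpaceFst ι Y ≫ i) (projectiveSpaceMap ι g) hm_w with hm
  have hm_fst : m ≫ pullback.fst _ _ = projectiveSpaceFst ι Y ≫ i := pullback.lift_fst _ _ _
  have hm_snd : m ≫ pullback.snd _ _ = projectiveSpaceMap ι g := pullback.lift_snd _ _ _
  have hsq : IsPullback m (projectiveSpaceFst ι Y) (pullback.fst _ _) i := by
    refine IsPullback.of_right (h₁₁ := m) ?_ hm_fst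
      (IsPullback.of_hasPullback (projectiveSpaceFst κ Z) (projectiveSpaceFst ι Z)).flip
    rw [hm_snd, hig]
    exact hP
  haveI : IsClosedImmersion m := MorphismProperty.of_isPullback hsq.flip hi
  haveI := hj
  -- the composite closed immersion `X ↪ 𝐏(τ; Z)`
  refine ⟨τ, hτ, j ≫ m ≫ (segreOver Z e).left, inferInstance, ?_⟩
  change (j ≫ m ≫ (segreOver Z e).left) ≫ projectiveSpaceFst τ Z = f ≫ g
  rw [Category.assoc, Category.assoc, segreOver_left_fst]
  have hm_fst' : m ≫ pullback.fst (Over.mk (projectiveSpaceFst κ Z)).hom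
      (Over.mk (projectiveSpaceFst ι Z)).hom = projectiveSpaceFst ι Y ≫ i := hm_fst
  rw [reassoc_of% hm_fst', hig, ← Category.assoc, hjf]

/-! ### Products -/

/-- **Fibre products of projective `S`-schemes are projective over `S`**: `X ×_S Y → X → S` is
the base change of `Y → S` followed by `X → S` (Hartshorne II Ex. 4.9; over a field this is the
tree's `Motives.IsProjectiveOver.tensor`). [cite: Hartshorne1977, II Ex. 4.9] -/
theorem prod {S : Scheme.{u}} {f : X ⟶ S} {g : Y ⟶ S} (hf : IsProjective f)
    (hg : IsProjective g) : IsProjective (pullback.fst f g ≫ f) :=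
  (pullback_fst f hg).comp hf

/-- The same in `Over S`: the tensor product (fibre product) of two projective objects is
projective. [cite: Hartshorne1977, II Ex. 4.9] -/
theorem tensorObj_hom {S : Scheme.{u}} {A B : Over S} (hA : IsProjective A.hom)
    (hB : IsProjective B.hom) : IsProjective (A ⊗ B).hom :=
  prod hA hB

end IsProjective

/-! ### Over a field: agreement with `Motives.IsProjectiveOver` -/

section Field

variable {k : Type u} [Field k]

/-- A closed `k`-immersion into `Motives.projectiveSpace m k = Proj k[x₀,…,xₘ]` with `m = #ι` makes
the structure morphism projective in Hartshorne's sense (`Proj k[x] ≅ 𝐏(ι; Spec k)` over `Spec k`,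
`Morphisms/ProjectiveSpaceOverAffine`). [cite: Hartshorne1977, II §4 Definition p.103 (projective morphism)] -/
theorem IsProjective.of_hom_projectiveSpace (ι : Type u) [Finite ι] {m : ℕ} (hm : Nat.card ι = m)
    {X : Motives.SchemeOver k} (c : X ⟶ Motives.projectiveSpace m k) [IsClosedImmersion c.left] :
    IsProjective X.hom := by
  subst hm
  letI : Algebra intU.{u} k := ULift.algebra' ℤ k
  refine ⟨ι, ‹_›, c.left ≫ (isPullback_projToSpec_projMap_terminal ι k).isoPullback.hom,
    inferInstance, ?_⟩
  rw [Category.assoc, projectiveSpaceSpec_isoPullback_hom_fst, ← Over.w c,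
    Motives.projectiveSpace_hom_eq_projToSpec]

/-- **Over a field, `Motives.IsProjectiveOver X` implies `IsProjective X.hom`.**
[cite: Hartshorne1977, II §4 Definition p.103 (projective morphism)] -/
theorem IsProjective.of_isProjectiveOver {X : Motives.SchemeOver k} (h : Motives.IsProjectiveOver X) :
    IsProjective X.hom := by
  obtain ⟨n, c, hc⟩ := h
  exact IsProjective.of_hom_projectiveSpace (ULift.{u} (Fin n)) (by rw [Nat.card_ulift, Nat.card_fin]) c

/-- **Over a field, `IsProjective X.hom` implies `Motives.IsProjectiveOver X`**: a closed immersion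
`X ↪ 𝐏(ι; Spec k) ≅ Proj k[x₀,…,x_{#ι}] = Motives.projectiveSpace (#ι) k`.
[cite: Hartshorne1977, II §4 Definition p.103 (projective morphism)] -/
theorem IsProjective.isProjectiveOver {X : Motives.SchemeOver k} (h : IsProjective X.hom) :
    Motives.IsProjectiveOver X := by
  obtain ⟨ι, hι, j, hj, hjf⟩ := h
  letI : Algebra intU.{u} k := ULift.algebra' ℤ k
  have hw : (j ≫ (isPullback_projToSpec_projMap_terminal ι k).isoPullback.inv) ≫
      (Motives.projectiveSpace (Nat.card ι) k).hom = X.hom := by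
    rw [Motives.projectiveSpace_hom_eq_projToSpec, Category.assoc,
      projectiveSpaceSpec_isoPullback_inv_projToSpec]
    exact hjf
  exact ⟨Nat.card ι, Over.homMk _ hw, by change IsClosedImmersion (j ≫ _); infer_instance⟩

/-- **Over a field the two notions of projectivity agree.**
[cite: Hartshorne1977, II §4 Definition p.103 (projective morphism)] -/
theorem isProjective_hom_iff_isProjectiveOver (X : Motives.SchemeOver k) :
    IsProjective X.hom ↔ Motives.IsProjectiveOver X :=
  ⟨IsProjective.isProjectiveOver, IsProjective.of_isProjectiveOver⟩

end Field

end Literature.AlgebraicGeometry.Morphisms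

end
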